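import Literature.AlgebraicGeometry.Motives.MorphismsToProjectiveSpace
import HarnessLib

/-!
# Generating sections of the trivial line bundle: morphisms to `ℙ(ι)` from functions without common zero

Topic `Literature/AlgebraicGeometry/Motives`; a definition + theorems, no named facts. Companion of
`Motives/MorphismsToProjectiveSpace` (Hartshorne II Thm. 7.1 in chart form,
`GeneratingSections`): the special case in which the invertible sheaf is `𝒪_Y` itself and the
generating sections are GLOBAL FUNCTIONS `s i ∈ Γ(Y, 𝒪_Y)`, `i ∈ ι`, without common zero
(`⨆ i, Y_{s i} = Y`). Hartshorne II Thm. 7.1 / Example 7.1.1: such a family defines the morphism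
`Y → ℙ(ι)`, `y ↦ (s_i(y))_i`, whose generating-sections data are the opens `Y_{s i}` and the ratios
`s j / s i ∈ Γ(Y, Y_{s i})` (Görtz–Wedhorn I, (13.8): the `S`-valued points of `ℙⁿ` given by
tuples `(s₀, …, sₙ)` generating the unit ideal, up to units).

* `GeneratingSections.ofFunctions s hs : GeneratingSections ι Y` — `U i = Y_{s i}`,
  `ratio i j = s j|_{Y_{s i}} · (s i|_{Y_{s i}})⁻¹`;
* `res_ratio_ofFunctions_mul` — pulled back along `g : T → Y` landing in `Y_{s i}`:
  `(s j / s i) · g^*(s i) = g^*(s j)`; `chartRingHom_ofFunctions_frac_mul` — the chart ring map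
  `(k[x]_{(x_i)})₀ → Γ(T, 𝒪_T)` sends `x_j/x_i` to the unique `t` with `t · g^*(s i) = g^*(s j)`;
* `toProj_ofFunctions_preimage_basicOpen` — the morphism `Y → ℙ(ι)` pulls `D₊(x_j)` back to `Y_{s j}`.

This is the form in which a unimodular vector of functions on an affine scheme `Spec C` (e.g. the
coefficients of a moving hyperplane) defines a morphism `Spec C → ℙⁿ` when NO coordinate is a unit
(the unit-coordinate case is `Motives/ProjectiveSpaceRingPoints`); used by the chart of Jouanolou's
torsor (`Motives/JouanolouTorsorChart`).

## References

* R. Hartshorne, *Algebraic Geometry*, GTM 52 (1977): II Thm. 7.1 and Example 7.1.1. [Hartshorne1977]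
* U. Görtz, T. Wedhorn, *Algebraic Geometry I*, 2nd ed. (2020): (13.8), p. 484. [GortzWedhorn2020]
-/

noncomputable section

universe u

open CategoryTheory AlgebraicGeometry Limits HomogeneousLocalization TopologicalSpace Opposite
open Literature.AlgebraicGeometry.Motives.Segre

namespace Literature.AlgebraicGeometry.Motives

-- `MvPolynomial.gradedAlgebra` is a `def` in Mathlib (no global instance), cf. `Motives/SegreEmbedding`.
attribute [local instance] MvPolynomial.gradedAlgebra

namespace GeneratingSections

variable {ι : Type} {Y : Scheme.{u}} (s : ι → Γ(Y, ⊤))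

/-! ### The ratios `s j / s i` on `Y_{s i}` -/

/-- The global function `s j` restricted to the non-vanishing locus `Y_{s i}` of `s i`.
[cite: Hartshorne1977, II Thm. 7.1] -/
def fnRes (i j : ι) : Γ(Y, Y.basicOpen (s i)) :=
  Y.presheaf.map (homOfLE (Y.basicOpen_le (s i))).op (s j)

/-- `s i` is a unit on `Y_{s i}` (Mathlib `RingedSpace.isUnit_res_basicOpen`). [cite: Hartshorne1977, II Thm. 7.1] -/
theorem isUnit_fnRes_self (i : ι) : IsUnit (fnRes s i i) :=
  Y.toRingedSpace.isUnit_res_basicOpen (s i)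

/-- The ratio `s j / s i ∈ Γ(Y, Y_{s i})`. [cite: Hartshorne1977, II Thm. 7.1] -/
def fnRatio (i j : ι) : Γ(Y, Y.basicOpen (s i)) :=
  fnRes s i j * ↑(isUnit_fnRes_self s i).unit⁻¹

/-- `(s j / s i) · s i = s j` on `Y_{s i}`. [cite: Hartshorne1977, II Thm. 7.1] -/
theorem fnRatio_mul_fnRes (i j : ι) : fnRatio s i j * fnRes s i i = fnRes s i j := by
  rw [fnRatio, mul_assoc, IsUnit.val_inv_mul, mul_one]

/-- `s i / s i = 1`. [cite: Hartshorne1977, II Thm. 7.1] -/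
theorem fnRatio_self (i : ι) : fnRatio s i i = 1 := by
  rw [fnRatio, IsUnit.mul_val_inv]

/-- The non-vanishing locus of `s j / s i` inside `Y_{s i}` is `Y_{s i} ∩ Y_{s j}`.
[cite: Hartshorne1977, II Thm. 7.1] -/
theorem basicOpen_fnRatio (i j : ι) :
    Y.basicOpen (fnRatio s i j) = Y.basicOpen (s i) ⊓ Y.basicOpen (s j) := by
  rw [fnRatio, Scheme.basicOpen_mul, Y.basicOpen_of_isUnit (Units.isUnit _), fnRes,
    Scheme.basicOpen_res, inf_right_comm, inf_idem]

/-- The cocycle rule `(s j / s i) · (s l / s j) = s l / s i` on `Y_{s i} ∩ Y_{s j}`.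
[cite: Hartshorne1977, II Thm. 7.1] -/
theorem fnRatio_mul_fnRatio (i j l : ι) :
    Y.presheaf.map (homOfLE inf_le_left).op (fnRatio s i j) *
        Y.presheaf.map (homOfLE inf_le_right).op (fnRatio s j l) =
      Y.presheaf.map (homOfLE (inf_le_left : Y.basicOpen (s i) ⊓ Y.basicOpen (s j) ≤ _)).op
        (fnRatio s i l) := by
  -- everything restricted to `W = Y_{s i} ∩ Y_{s j}`
  set W : Y.Opens := Y.basicOpen (s i) ⊓ Y.basicOpen (s j) with hW
  set ri := Y.presheaf.map (homOfLE (inf_le_left : W ≤ Y.basicOpen (s i))).op with hri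
  set rj := Y.presheaf.map (homOfLE (inf_le_right : W ≤ Y.basicOpen (s j))).op with hrj
  -- the restrictions of the global functions to `W` through either chart agree
  have hres : ∀ l', ri (fnRes s i l') = rj (fnRes s j l') := by
    intro l'
    simp only [hri, hrj, fnRes, ← CommRingCat.comp_apply, ← Functor.map_comp]
    rfl
  -- units
  have hui : ri (fnRes s i i) * ri ↑(isUnit_fnRes_self s i).unit⁻¹ = 1 := by
    rw [← map_mul, IsUnit.mul_val_inv, map_one]
  have huj : rj (fnRes s j j) * rj ↑(isUnit_fnRes_self s j).unit⁻¹ = 1 := by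
    rw [← map_mul, IsUnit.mul_val_inv, map_one]
  simp only [fnRatio, map_mul]
  rw [hres l]
  -- goal: ri(s j) * ri(ui⁻¹) * (rj(s l) * rj(uj⁻¹)) = rj (s l) * ri(ui⁻¹), with ri (s j) = rj (s j)
  have key : ri (fnRes s i j) * rj ↑(isUnit_fnRes_self s j).unit⁻¹ = 1 := by
    rw [hres j]; exact huj
  linear_combination (rj (fnRes s j l) * ri ↑(isUnit_fnRes_self s i).unit⁻¹) * key

/-! ### The generating-sections data -/

variable (hs : ⨆ i, Y.basicOpen (s i) = ⊤)

/-- **Generating-sections data of a family of global functions without common zero**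
(Hartshorne II Thm. 7.1 with `𝓛 = 𝒪_Y`, Example 7.1.1): the opens `Y_{s i}` and the ratios
`s j / s i`. [cite: Hartshorne1977, II Thm. 7.1 and Example 7.1.1] -/
def ofFunctions : GeneratingSections ι Y where
  U i := Y.basicOpen (s i)
  iSup_U := hs
  ratio := fnRatio s
  ratio_self := fnRatio_self s
  basicOpen_ratio := basicOpen_fnRatio s
  ratio_mul_ratio := fnRatio_mul_fnRatio s

/-- The opens of `ofFunctions` are the `Y_{s i}`. [cite: Hartshorne1977, II Thm. 7.1] -/
@[simp] theorem ofFunctions_U (i : ι) : (ofFunctions s hs).U i = Y.basicOpen (s i) := rfl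

/-- The ratios of `ofFunctions` are the `s j / s i`. [cite: Hartshorne1977, II Thm. 7.1] -/
@[simp] theorem ofFunctions_ratio (i j : ι) : (ofFunctions s hs).ratio i j = fnRatio s i j := rfl

/-! ### Pull-backs along a morphism landing in `Y_{s i}` -/

section Pullback

variable {T : Scheme.{u}} (g : T ⟶ Y) {i : ι} (hg : ⊤ ≤ g ⁻¹ᵁ Y.basicOpen (s i))

/-- Pulling back `s j|_{Y_{s i}}` along `g : T → Y` with image in `Y_{s i}` gives `g^*(s j)`.
[cite: Hartshorne1977, II Thm. 7.1] -/
theorem res_fnRes (j : ι) : res g (Y.basicOpen (s i)) hg (fnRes s i j) = g.appTop (s j) := by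
  rw [fnRes, res_map g ⊤ le_top hg (Y.basicOpen_le (s i)) (s j), res_top]

/-- `g^*(s i)` is a unit when `g` lands in `Y_{s i}`. [cite: Hartshorne1977, II Thm. 7.1] -/
theorem isUnit_appTop (i : ι) (hg : ⊤ ≤ g ⁻¹ᵁ Y.basicOpen (s i)) : IsUnit (g.appTop (s i)) := by
  rw [← res_fnRes s g hg i]
  exact (isUnit_fnRes_self s i).map _

/-- **The pulled-back ratio**: `g^*(s j / s i) · g^*(s i) = g^*(s j)`. [cite: Hartshorne1977, II Thm. 7.1] -/
theorem res_fnRatio_mul (j : ι) :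
    res g (Y.basicOpen (s i)) hg (fnRatio s i j) * g.appTop (s i) = g.appTop (s j) := by
  rw [← res_fnRes s g hg i, ← map_mul, fnRatio_mul_fnRes, res_fnRes]

/-- The pulled-back ratio is `g^*(s j) · (g^*(s i))⁻¹`. [cite: Hartshorne1977, II Thm. 7.1] -/
theorem res_fnRatio_eq (j : ι) :
    res g (Y.basicOpen (s i)) hg (fnRatio s i j) =
      g.appTop (s j) * ↑(isUnit_appTop s g i hg).unit⁻¹ := by
  rw [← res_fnRatio_mul s g hg j, mul_assoc, IsUnit.mul_val_inv, mul_one]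

variable {k : Type u} [CommRing k] (f : Y ⟶ Spec (.of k))

/-- **The chart ring map of `ofFunctions`** on the generators: `(k[x]_{(x_i)})₀ → Γ(T, 𝒪_T)` sends
`x_j / x_i` to `g^*(s j) · (g^*(s i))⁻¹` (Hartshorne II, proof of Thm. 7.1: «`x_j/x_i ↦ s_j/s_i`»).
[cite: Hartshorne1977, II Thm. 7.1 (proof)] -/
theorem chartRingHom_ofFunctions_frac_mul (j : ι) :
    (ofFunctions s hs).chartRingHom f i g hg (frac k i j) * g.appTop (s i) = g.appTop (s j) := by
  rw [chartRingHom_frac]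
  exact res_fnRatio_mul s g hg j

/-- The same, solved for the image of `x_j / x_i`. [cite: Hartshorne1977, II Thm. 7.1 (proof)] -/
theorem chartRingHom_ofFunctions_frac (j : ι) :
    (ofFunctions s hs).chartRingHom f i g hg (frac k i j) =
      g.appTop (s j) * ↑(isUnit_appTop s g i hg).unit⁻¹ := by
  rw [chartRingHom_frac]
  exact res_fnRatio_eq s g hg j

end Pullback

/-! ### The morphism to `ℙ(ι)` -/

section ToProj

variable {k : Type u} [CommRing k] (f : Y ⟶ Spec (.of k))

/-- The morphism `Y → ℙ(ι)_k` defined by the functions `s i` pulls the chart `D₊(x_j)` back to the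
non-vanishing locus `Y_{s j}`. [cite: Hartshorne1977, II Thm. 7.1] -/
theorem toProj_ofFunctions_preimage_basicOpen (j : ι) :
    (ofFunctions s hs).toProj f ⁻¹ᵁ Proj.basicOpen (grading ι k) (MvPolynomial.X j) = Y.basicOpen (s j) :=
  (ofFunctions s hs).toProj_preimage_basicOpen f j

/-- Restricted along `g : T → Y` with image in `Y_{s i}`, the morphism `Y → ℙ(ι)_k` is the chart map
`T → D₊(x_i) ⊆ ℙ(ι)`, i.e. `T.toSpecΓ ≫ Spec (x_j/x_i ↦ g^* s_j / g^* s_i) ≫ (D₊(x_i) ↪ ℙ(ι))`.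
[cite: Hartshorne1977, II Thm. 7.1 (proof)] -/
theorem comp_toProj_ofFunctions {T : Scheme.{u}} (g : T ⟶ Y) {i : ι}
    (hg : ⊤ ≤ g ⁻¹ᵁ Y.basicOpen (s i)) :
    g ≫ (ofFunctions s hs).toProj f =
      T.toSpecΓ ≫ Spec.map (CommRingCat.ofHom ((ofFunctions s hs).chartRingHom f i g hg)) ≫ chartι k i :=
  (ofFunctions s hs).comp_toProj f g hg

end ToProj

end GeneratingSections

end Literature.AlgebraicGeometry.Motives

end
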